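import Mathlib
import Literature.MathematicalPhysics.QuantumLattice.HubbardBandSectorCountingCounts
import HarnessLib

/-!
# Four-sector counting on the band Fermi curve: the COOPER range with a THIN (shift-affine) tolerance has NO logarithm in `N`

Topic `Literature/MathematicalPhysics/QuantumLattice`; sub-namespace `BandSectorCounting` (continues `HubbardBandSectorCountingCounts`).
Second file of the log-free ANISOTROPIC anchored four-sector counting lemma («E1-P2-THIN-COUNT», cell gate-hubbard-kl, plan g17 (R41); seat p4;
plan HOME/prover-p4/E1-P2-THIN-COUNT-PLAN.md).  In the isotropic lemma (`count_odd_total`, BGM 2006 Lemma 3.1 / App. A2) the Cooper range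
`|kw − π| ≤ τ` of shifts `θ_c = θ_a + kw` is counted at the CONSTANT tolerance `δ = C_δ·w` and produces the printed logarithm `(2δ/(h_min w))·2(1 + log N)/w
≍ N·log N` (Mastropietro, *Non-Perturbative Renormalization*, p. 229: «the sector lemma for isotropic sectors gives γ^{−h}|h|»).  For the engine's THIN
anisotropic boxes the existence condition along a Cooper-range shift `c = kw` is instead `|h(θ_a, θ_a + c)| ≤ δ₀ + δ₁·|c − π|` with `δ₀ ≍ w²` (radial
thickness) and `δ₁ ≍ w` (the boxes' TANGENTIAL widths feed the level of the fourth leg only through the Fermi-velocity rotation `∝ |c − π|` along the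
shift — the design note of the plan, «gradient-weighted tolerance»).  This file runs `count_odd_shift` VERBATIM at the shift-dependent tolerance
`δ_k := δ₀ + δ₁·|kw − π|` and sums:

* **`count_odd_total_affine`** — `Σ_{|kw−π| ≤ τ} #{a < N : |h(θ_a, θ_a + kw)| ≤ δ₀ + δ₁|kw − π| ∧ (transversality as in count_odd_total)} ≤
  N·(2·(4δ₀/(η_o w)) + 1) + 2C₅·((2δ₀/(h_min w))·2(1 + log N)/w + (2δ₁/(h_min w))·N + N)`, `C₅ = 2π/(η_o/(8A₂)) + 1`, under `δ₁ ≤ η_o/4` and the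
  smallness `hsmall` of `count_odd_total`.  With `δ₀ = C₀w²`, `δ₁ = C₁w` the right side is `N·(8C₀w/η_o + 1) + 2C₅·(8C₀(1 + log N)/h_min + 2C₁N/h_min + N)`
  = `O(N)` + an ADDITIVE `O(log N)` — **`count_odd_total_thin`**.  NO multiplicative `log N` (Mastropietro (14.67), p. 223: anchored anisotropic count
  `≤ c·γ^{(h₀−h)/2}`, no `|h|`).

Everything is PROVED (the iso file's `count_odd_shift`, `card_shifts_near_pi_le`, `sum_inv_abs_sub_le`); no definitions, no named facts.

## Sources

* V. Mastropietro, *Non-Perturbative Renormalization* (World Scientific, 2008), ch. 14, (14.67) p. 223; p. 229. [Mastropietro2008]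
* G. Benfatto, A. Giuliani, V. Mastropietro, Ann. Henri Poincaré 7 (2006) 809–898, Lemma 3.1, App. A2, (2.89)/App. A3. [BenfattoGiulianiMastropietro2006]
-/

noncomputable section

open Real Set
open Literature.MathematicalPhysics.QuantumLattice

namespace Literature.MathematicalPhysics.QuantumLattice.BandSectorCounting

section Assembly

variable {a b : ℝ} (B : BandBounds a b) {μ : ℝ} (hμ : μ ∈ Icc a b)
include B hμ

/-- **The Cooper range at the shift-affine tolerance `δ_k = δ₀ + δ₁·|kw − π|`**:
`Σ_{|kw−π| ≤ τ} #{a < N : |h(θ_a, θ_a+kw)| ≤ δ₀ + δ₁|kw−π| ∧ |∂₃h| < λ at both orders} ≤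
N·(2·(4δ₀/(η_o w)) + 1) + 2C₅·((2δ₀/(h_min w))·2(1+log N)/w + (2δ₁/(h_min w))·N + N)` — `count_odd_shift` verbatim per shift, then the harmonic sum for the
`δ₀`-part and a plain count for the `δ₁`-part. [cite: Mastropietro2008, ch. 14 (14.67)] -/
theorem count_odd_total_affine {θ₁ w δ₀ δ₁ lam τ ηo : ℝ} (hw : 0 < w) {N Nh : ℕ} (hN : (N : ℝ) * w = 2 * π)
    (hNh : (Nh : ℝ) * w = π) (hNN : N = 2 * Nh) (hδ₀ : 0 < δ₀) (hδ₁ : 0 ≤ δ₁) (hηo : 0 < ηo) (hδ₁η : δ₁ ≤ ηo / 4)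
    (hsmall : 4 * B.A2 * B.smax * (2 * τ + 2 * B.Cg * B.smax ^ 2 * τ + B.Cg * (ηo / 2)) ≤ B.hmin) :
    ∑ k ∈ (Finset.range N).filter (fun k : ℕ => |(k : ℝ) * w - π| ≤ τ), ((((Finset.range N).filter fun i : ℕ =>
        |hfun μ θ₁ (w / 2 + i * w) (w / 2 + i * w + k * w)| ≤ δ₀ + δ₁ * |(k : ℝ) * w - π| ∧
        |h3 μ θ₁ (w / 2 + i * w) (w / 2 + i * w + k * w)| < lam ∧
        |h3 μ θ₁ (w / 2 + i * w + k * w) (w / 2 + i * w)| < lam).card : ℝ)) ≤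
      N * (2 * (4 * δ₀ / (ηo * w)) + 1) +
      2 * (2 * π / (ηo / (8 * B.A2)) + 1) *
        ((2 * δ₀ / (B.hmin * w)) * (2 * (1 + Real.log N)) / w + (2 * δ₁ / (B.hmin * w)) * N + N) := by
  have hA := B.A2_pos; have hh := B.hmin_pos
  have hNh0 : 0 < Nh := by
    rcases Nat.eq_zero_or_pos Nh with h0 | h0
    · exfalso; rw [h0] at hNh; simp at hNh; linarith [Real.pi_pos]
    · exact h0
  have hNhN : Nh < N := by omega
  set S := (Finset.range N).filter (fun k : ℕ => |(k : ℝ) * w - π| ≤ τ) with hS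
  set f : ℕ → ℝ := fun k => ((((Finset.range N).filter fun i : ℕ =>
        |hfun μ θ₁ (w / 2 + i * w) (w / 2 + i * w + k * w)| ≤ δ₀ + δ₁ * |(k : ℝ) * w - π| ∧
        |h3 μ θ₁ (w / 2 + i * w) (w / 2 + i * w + k * w)| < lam ∧
        |h3 μ θ₁ (w / 2 + i * w + k * w) (w / 2 + i * w)| < lam).card : ℝ)) with hf
  have hf0 : ∀ k, 0 ≤ f k := fun k => by positivity
  have hfN : ∀ k, f k ≤ N := by
    intro k
    rw [hf]; dsimp only
    have := Finset.card_filter_le (Finset.range N) (fun i : ℕ =>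
        |hfun μ θ₁ (w / 2 + i * w) (w / 2 + i * w + k * w)| ≤ δ₀ + δ₁ * |(k : ℝ) * w - π| ∧
        |h3 μ θ₁ (w / 2 + i * w) (w / 2 + i * w + k * w)| < lam ∧
        |h3 μ θ₁ (w / 2 + i * w + k * w) (w / 2 + i * w)| < lam)
    rw [Finset.card_range] at this
    exact_mod_cast this
  -- split `S` into the trivial shifts `|kw − π| < 4δ₀/η_o` and the good shifts
  set d := 4 * δ₀ / (ηo * w) with hd
  have hd0 : 0 ≤ d := by positivity
  have hdw : d * w = 4 * δ₀ / ηo := by rw [hd]; field_simp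
  rw [← Finset.sum_filter_add_sum_filter_not S (fun k : ℕ => |(k : ℝ) * w - π| < d * w)]
  have htriv : ∑ k ∈ S.filter (fun k : ℕ => |(k : ℝ) * w - π| < d * w), f k ≤ N * (2 * d + 1) := by
    have hcard : (((S.filter (fun k : ℕ => |(k : ℝ) * w - π| < d * w)).card : ℝ)) ≤ 2 * d + 1 := by
      have : S.filter (fun k : ℕ => |(k : ℝ) * w - π| < d * w) =
          (Finset.range N).filter (fun k : ℕ => |(k : ℝ) * w - π| < d * w ∧ |(k : ℝ) * w - π| ≤ τ) := by
        rw [hS, Finset.filter_filter]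
        refine Finset.filter_congr fun k _ => ?_
        tauto
      rw [this]; exact card_shifts_near_pi_le hw hd0 N _
    calc ∑ k ∈ S.filter (fun k : ℕ => |(k : ℝ) * w - π| < d * w), f k
        ≤ ∑ k ∈ S.filter (fun k : ℕ => |(k : ℝ) * w - π| < d * w), (N : ℝ) := Finset.sum_le_sum fun k _ => hfN k
      _ = ((S.filter (fun k : ℕ => |(k : ℝ) * w - π| < d * w)).card : ℝ) * N := by rw [Finset.sum_const, nsmul_eq_mul]
      _ ≤ (2 * d + 1) * N := mul_le_mul_of_nonneg_right hcard (by positivity)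
      _ = N * (2 * d + 1) := by ring
  have hgood : ∑ k ∈ S.filter (fun k : ℕ => ¬ |(k : ℝ) * w - π| < d * w), f k ≤
      2 * (2 * π / (ηo / (8 * B.A2)) + 1) *
        ((2 * δ₀ / (B.hmin * w)) * (2 * (1 + Real.log N)) / w + (2 * δ₁ / (B.hmin * w)) * N + N) := by
    set C₅ := 2 * π / (ηo / (8 * B.A2)) + 1 with hC₅
    have hC₅0 : 0 ≤ C₅ := by positivity
    have hterm : ∀ k ∈ S.filter (fun k : ℕ => ¬ |(k : ℝ) * w - π| < d * w),
        f k ≤ C₅ * (2 * ((2 * δ₀ / (B.hmin * w)) * (1 / |(k : ℝ) - Nh|) / w + (2 * δ₁ / (B.hmin * w)) + 1)) := by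
      intro k hk
      rw [Finset.mem_filter, hS, Finset.mem_filter, Finset.mem_range, not_lt] at hk
      obtain ⟨⟨hkN, hkτ⟩, hkd⟩ := hk
      rw [hdw] at hkd
      have hcpos : 0 < |(k : ℝ) * w - π| := lt_of_lt_of_le (by positivity) hkd
      -- the shift's own tolerance
      set δ := δ₀ + δ₁ * |(k : ℝ) * w - π| with hδdef
      have hδnn : 0 ≤ δ := by positivity
      have hmono : f k ≤ ((((Finset.range N).filter fun i : ℕ =>
          |hfun μ θ₁ (w / 2 + i * w) (w / 2 + i * w + k * w)| ≤ δ).card : ℝ)) := by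
        rw [hf]; dsimp only
        have hsub' : ((Finset.range N).filter fun i : ℕ =>
            |hfun μ θ₁ (w / 2 + i * w) (w / 2 + i * w + k * w)| ≤ δ₀ + δ₁ * |(k : ℝ) * w - π| ∧
            |h3 μ θ₁ (w / 2 + i * w) (w / 2 + i * w + k * w)| < lam ∧
            |h3 μ θ₁ (w / 2 + i * w + k * w) (w / 2 + i * w)| < lam) ⊆
            ((Finset.range N).filter fun i : ℕ => |hfun μ θ₁ (w / 2 + i * w) (w / 2 + i * w + k * w)| ≤ δ) := by
          intro i hi
          rw [Finset.mem_filter] at hi ⊢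
          exact ⟨hi.1, hi.2.1⟩
        exact_mod_cast Finset.card_le_card hsub'
      -- `δ_k ≤ η_o|c − π|/2`: `δ₀ ≤ η_o|c−π|/4` (good shift) and `δ₁|c−π| ≤ η_o|c−π|/4`
      have hδc : δ ≤ ηo * |(k : ℝ) * w - π| / 2 := by
        have h1 : 4 * δ₀ ≤ ηo * |(k : ℝ) * w - π| := by rw [div_le_iff₀' hηo] at hkd; linarith
        have h2 : δ₁ * |(k : ℝ) * w - π| ≤ ηo / 4 * |(k : ℝ) * w - π| := mul_le_mul_of_nonneg_right hδ₁η hcpos.le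
        rw [hδdef]; linarith
      have hL := count_odd_shift B hμ (θ₁ := θ₁) hw hN hδnn hηo hkτ hcpos hδc hsmall
      have hkey : |(k : ℝ) * w - π| = |(k : ℝ) - Nh| * w := by
        rw [← hNh, show (k : ℝ) * w - Nh * w = ((k : ℝ) - Nh) * w by ring, abs_mul, abs_of_pos hw]
      refine hmono.trans (hL.trans (le_of_eq ?_))
      have hkNh : (k : ℝ) - Nh ≠ 0 := by
        intro h0; rw [hkey, h0, abs_zero, zero_mul] at hcpos; exact lt_irrefl _ hcpos
      have habs : |(k : ℝ) - Nh| ≠ 0 := abs_ne_zero.2 hkNh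
      rw [hδdef, hkey, hC₅]
      field_simp
    have hsub : S.filter (fun k : ℕ => ¬ |(k : ℝ) * w - π| < d * w) ⊆ (Finset.range N).filter (fun k => k ≠ Nh) := by
      intro k hk
      rw [Finset.mem_filter, hS, Finset.mem_filter, not_lt] at hk
      rw [Finset.mem_filter]
      refine ⟨hk.1.1, fun hkeq => ?_⟩
      rw [hkeq, hNh, sub_self, abs_zero, hdw] at hk
      have : 0 < 4 * δ₀ / ηo := by positivity
      linarith [hk.2]
    calc ∑ k ∈ S.filter (fun k : ℕ => ¬ |(k : ℝ) * w - π| < d * w), f k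
        ≤ ∑ k ∈ S.filter (fun k : ℕ => ¬ |(k : ℝ) * w - π| < d * w),
            C₅ * (2 * ((2 * δ₀ / (B.hmin * w)) * (1 / |(k : ℝ) - Nh|) / w + (2 * δ₁ / (B.hmin * w)) + 1)) :=
          Finset.sum_le_sum hterm
      _ ≤ ∑ k ∈ (Finset.range N).filter (fun k => k ≠ Nh),
            C₅ * (2 * ((2 * δ₀ / (B.hmin * w)) * (1 / |(k : ℝ) - Nh|) / w + (2 * δ₁ / (B.hmin * w)) + 1)) :=
          Finset.sum_le_sum_of_subset_of_nonneg hsub fun k _ _ => by positivity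
      _ = (2 * C₅ * (2 * δ₀ / (B.hmin * w)) / w) * ∑ k ∈ (Finset.range N).filter (fun k => k ≠ Nh), 1 / |(k : ℝ) - Nh|
            + 2 * C₅ * ((2 * δ₁ / (B.hmin * w)) + 1) * (((Finset.range N).filter (fun k => k ≠ Nh)).card : ℝ) := by
          have hrw : ∀ k : ℕ, C₅ * (2 * ((2 * δ₀ / (B.hmin * w)) * (1 / |(k : ℝ) - Nh|) / w + (2 * δ₁ / (B.hmin * w)) + 1)) =
              (2 * C₅ * (2 * δ₀ / (B.hmin * w)) / w) * (1 / |(k : ℝ) - Nh|) + 2 * C₅ * ((2 * δ₁ / (B.hmin * w)) + 1) := by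
            intro k; ring
          rw [Finset.sum_congr rfl (fun k _ => hrw k), Finset.sum_add_distrib, ← Finset.mul_sum, Finset.sum_const,
            nsmul_eq_mul]
          ring
      _ ≤ (2 * C₅ * (2 * δ₀ / (B.hmin * w)) / w) * (2 * (1 + Real.log N)) + 2 * C₅ * ((2 * δ₁ / (B.hmin * w)) + 1) * N := by
          apply add_le_add
          · exact mul_le_mul_of_nonneg_left (sum_inv_abs_sub_le hNhN) (by positivity)
          · apply mul_le_mul_of_nonneg_left _ (by positivity)
            calc ((((Finset.range N).filter (fun k => k ≠ Nh)).card : ℝ)) ≤ ((Finset.range N).card : ℝ) := by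
                  exact_mod_cast Finset.card_filter_le _ _
              _ = N := by rw [Finset.card_range]
      _ = 2 * C₅ * ((2 * δ₀ / (B.hmin * w)) * (2 * (1 + Real.log N)) / w + (2 * δ₁ / (B.hmin * w)) * N + N) := by ring
  rw [hd] at htriv
  linarith

/-- **The Cooper range with THIN boxes has no multiplicative logarithm**: at `δ₀ = C₀·w²` (radial thickness) and `δ₁ = C₁·w` (tangential width ×
velocity rotation along the shift), `C₁w ≤ η_o/4`, the Cooper-range count is
`≤ N·(8C₀w/η_o + 1) + 2C₅·(8C₀(1 + log N)/h_min + 2C₁N/h_min + N)` — linear in `N` plus an ADDITIVE `log N` (vs the isotropic `N·log N`).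
[cite: Mastropietro2008, ch. 14 (14.67)] -/
theorem count_odd_total_thin {θ₁ w C₀ C₁ lam τ ηo : ℝ} (hw : 0 < w) {N Nh : ℕ} (hN : (N : ℝ) * w = 2 * π)
    (hNh : (Nh : ℝ) * w = π) (hNN : N = 2 * Nh) (hC₀ : 0 < C₀) (hC₁ : 0 ≤ C₁) (hηo : 0 < ηo) (hC₁η : C₁ * w ≤ ηo / 4)
    (hsmall : 4 * B.A2 * B.smax * (2 * τ + 2 * B.Cg * B.smax ^ 2 * τ + B.Cg * (ηo / 2)) ≤ B.hmin) :
    ∑ k ∈ (Finset.range N).filter (fun k : ℕ => |(k : ℝ) * w - π| ≤ τ), ((((Finset.range N).filter fun i : ℕ =>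
        |hfun μ θ₁ (w / 2 + i * w) (w / 2 + i * w + k * w)| ≤ C₀ * w ^ 2 + C₁ * w * |(k : ℝ) * w - π| ∧
        |h3 μ θ₁ (w / 2 + i * w) (w / 2 + i * w + k * w)| < lam ∧
        |h3 μ θ₁ (w / 2 + i * w + k * w) (w / 2 + i * w)| < lam).card : ℝ)) ≤
      N * (2 * (4 * C₀ * w / ηo) + 1) +
      2 * (2 * π / (ηo / (8 * B.A2)) + 1) * ((2 * C₀ / B.hmin) * (2 * (1 + Real.log N)) + (2 * C₁ / B.hmin) * N + N) := by
  have hh := B.hmin_pos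
  have h := count_odd_total_affine B hμ (θ₁ := θ₁) (lam := lam) hw hN hNh hNN (δ₀ := C₀ * w ^ 2) (δ₁ := C₁ * w) (by positivity)
    (by positivity) hηo hC₁η hsmall
  have e1 : 4 * (C₀ * w ^ 2) / (ηo * w) = 4 * C₀ * w / ηo := by field_simp
  have e2 : 2 * (C₀ * w ^ 2) / (B.hmin * w) * (2 * (1 + Real.log N)) / w = (2 * C₀ / B.hmin) * (2 * (1 + Real.log N)) := by
    field_simp
  have e3 : 2 * (C₁ * w) / (B.hmin * w) = 2 * C₁ / B.hmin := by field_simp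
  rw [e1, e2, e3] at h
  exact h

end Assembly

end Literature.MathematicalPhysics.QuantumLattice.BandSectorCounting

end
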